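import Summits.QuantumFields.YangMills.Theorems.LuscherReductionDressedRitzPolyakovLiftTransplantMultiplet
import Summits.QuantumFields.YangMills.Theorems.LuscherReductionDressedRitzPolyakovLiftStaticsOfSeparationReflectionTwirl
import HarnessLib

/-!
# Line «polyakovlift» r7 on crux `DressedRitz` (stmt-QuantumFields-20205): S-STAT (o2) — the FULL signed-permutation (hyperoctahedral, `B₃`, 48 elements)
# twirl on the root chart, and its transfer to transplant bases (Schur row projectors)

Fleet-service module of seat ym-infvol-p1 g7.  `…TransplantMultiplet` §3 transfers clause (b) of `PairSeparated` (weighted twirls) from FLAT identities for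
any finite family of chart-equivariant lift symmetries.  This file instantiates it with the whole group `B₃ = (ℤ/2)³ ⋊ S₃` of signed axis permutations
acting on the one-site links (`g = (s, π)`: permute the axes by `π`, then invert the links `k` with `s k`), which the root chart intertwines with the signed
row permutations `N_s ∘ P_π` of `ℝ⁹`:

* §1 `signFlip_apply`, `linkNormSq_signFlip`, `rootRescale_signFlip`, `gnCoord_linkFlip`, ★ `rootCoord_linkFlip` (seat g6's link-flip patterns `linkFlip s`
  of `…StaticsOfSeparationReflectionTwirl` ↦ row sign patterns `N_s` on the chart), `groundState_signFlip_of_isEigenFamily` (`f_0 ∘ N_s = f_0`);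
* §2 `octPair_involutive` (the inverse pairing `(s, π) ↦ (s ∘ π, π⁻¹)`), `octAct_pair` (`γ_g ∘ γ_{ι g} = id` for `γ_{(s,π)} = linkFlip s ∘ configPerm π`),
  `isLiftSymmetry_octAct`, ★ `rootCoord_octAct`;
* §3 ★★ `pairSeparated_transplantObsL_of_octTwirl` — if a `ι`-symmetric weight `w` on `B₃` makes the FLAT twirl `Σ_g w_g f_{i+1}(N_{s}P_{π} y)` reproduce `f_{i+1}`
  and kill `f_{l+1}` (or vice versa), the transplanted pair is `PairSeparated`.  By Schur orthogonality this covers EVERY pair of AL1 channels lying in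
  inequivalent `B₃`-isotypes, in different rows of one irreducible multiplet, or in orthogonal rows `p ⊥ q` of two equivalent multiplets — everything except two
  channels in the SAME row of equivalent irreducibles (e.g. two `A₁⁺` radial excitations), which no symmetry separates (the RG core of S-STAT″).

HONEST FRAMING: bookkeeping on the conditional femto rung R2b1; the flat identities are hypotheses (spectral input on `𝔥`); not infinite volume, not a gap,
not Clay.  References: M. Lüscher, NPB 219 (1983) 233 [cite: Luscher1983, §2–§3]; M. Lüscher, G. Münster, NPB 232 (1984) 445 [cite: LuscherMunster1984, §4].
-/

set_option autoImplicit false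

noncomputable section

open MeasureTheory Filter Topology Real
open Literature.MathematicalPhysics.QuantumFieldTheory (GaugeConfig Site gaugeTransform configPerm configPerm_apply sitePerm)
open Literature.Analysis.OperatorTheory.YMMatrixModel
open scoped BigOperators

namespace Summit.QuantumFields.YangMills.Theorems.FemtoTransferGap.PolyakovLift

open Summit.QuantumFields.YangMills.Theorems.FemtoTransferGap

variable {k : ℕ}

/-! ## §1 Link-flip patterns on the root chart -/

/-- Coordinates of the row sign pattern `N_s`. [folklore] -/
theorem signFlip_apply (s : Fin 3 → Bool) (y : ZM) (p : Fin 3 × Fin 3) :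
    LinearIsometryEquiv.piLpCongrRight 2
        (fun q : Fin 3 × Fin 3 => if s q.1 = true then LinearIsometryEquiv.neg ℝ (E := ℝ) else LinearIsometryEquiv.refl ℝ ℝ) y p =
      if s p.1 = true then -y p else y p := by
  rw [LinearIsometryEquiv.piLpCongrRight_apply]
  show (if s p.1 = true then LinearIsometryEquiv.neg ℝ (E := ℝ) else LinearIsometryEquiv.refl ℝ ℝ) (y p) = _
  split_ifs with h
  · rfl
  · rfl

/-- Row sign patterns preserve the link norms. [folklore] -/
theorem linkNormSq_signFlip (s : Fin 3 → Bool) (y : ZM) (i : Fin 3) :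
    linkNormSq (LinearIsometryEquiv.piLpCongrRight 2
        (fun q : Fin 3 × Fin 3 => if s q.1 = true then LinearIsometryEquiv.neg ℝ (E := ℝ) else LinearIsometryEquiv.refl ℝ ℝ) y) i = linkNormSq y i := by
  unfold linkNormSq
  refine Finset.sum_congr rfl fun a _ => ?_
  rw [signFlip_apply]
  split_ifs
  · exact neg_sq _
  · rfl

/-- The root rescaling commutes with row sign patterns. [folklore] -/
theorem rootRescale_signFlip (L : ℕ) (μ : ℝ) (s : Fin 3 → Bool) (y : ZM) :
    rootRescale L μ (LinearIsometryEquiv.piLpCongrRight 2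
        (fun q : Fin 3 × Fin 3 => if s q.1 = true then LinearIsometryEquiv.neg ℝ (E := ℝ) else LinearIsometryEquiv.refl ℝ ℝ) y) =
      LinearIsometryEquiv.piLpCongrRight 2
        (fun q : Fin 3 × Fin 3 => if s q.1 = true then LinearIsometryEquiv.neg ℝ (E := ℝ) else LinearIsometryEquiv.refl ℝ ℝ) (rootRescale L μ y) := by
  ext p
  rw [rootRescale_apply, linkNormSq_signFlip, signFlip_apply, signFlip_apply, rootRescale_apply]
  split_ifs
  · exact mul_neg _ _
  · rfl

/-- The gnomonic chart sends the link-flip pattern `linkFlip s` to the row sign pattern `N_s`. [cite: Luscher1983, §2] -/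
theorem gnCoord_linkFlip (μ : ℝ) (s : Fin 3 → Bool) (V : Cfg) :
    gnCoord μ (linkFlip s V) =
      LinearIsometryEquiv.piLpCongrRight 2
        (fun q : Fin 3 × Fin 3 => if s q.1 = true then LinearIsometryEquiv.neg ℝ (E := ℝ) else LinearIsometryEquiv.refl ℝ ℝ) (gnCoord μ V) := by
  ext p
  rw [gnCoord_apply, signFlip_apply, gnCoord_apply]
  show gnLink (bif s p.1 then (V (edgeOf p.1))⁻¹ else V (edgeOf p.1)) p.2 / μ = _
  cases s p.1
  · simp
  · simp [gnLink_inv, neg_div]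

/-- ★ **The root chart sends `linkFlip s` to the row sign pattern `N_s`.** [cite: Luscher1983, §2] -/
theorem rootCoord_linkFlip (L : ℕ) (μ : ℝ) (s : Fin 3 → Bool) (V : Cfg) :
    rootCoord L μ (linkFlip s V) =
      LinearIsometryEquiv.piLpCongrRight 2
        (fun q : Fin 3 × Fin 3 => if s q.1 = true then LinearIsometryEquiv.neg ℝ (E := ℝ) else LinearIsometryEquiv.refl ℝ ℝ) (rootCoord L μ V) := by
  unfold rootCoord
  rw [gnCoord_linkFlip, rootRescale_signFlip]

/-- `f_0 ∘ N_s = f_0` for an AL1 family with `f_0 > 0` (`N_s` is a composite of single row sign flips). [cite: Luscher1983, §2] [cite: ReedSimonIV1978, Thm. XIII.47–48] -/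
theorem groundState_signFlip_of_isEigenFamily {f : Fin (k + 1) → ZM → ℝ} (hf : IsEigenFamily k f) (hpos : ∀ x, 0 < f 0 x)
    (s : Fin 3 → Bool) (y : ZM) :
    f 0 (LinearIsometryEquiv.piLpCongrRight 2
        (fun q : Fin 3 × Fin 3 => if s q.1 = true then LinearIsometryEquiv.neg ℝ (E := ℝ) else LinearIsometryEquiv.refl ℝ ℝ) y) = f 0 y := by
  -- factor `N_s = M_0 ∘ M_1 ∘ M_2`, `M_k = N_k` if `s k`, else `id`
  have hopt : ∀ (kx : Fin 3) (b : Bool) (z : ZM), f 0 (if b = true then LinearIsometryEquiv.piLpCongrRight 2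
      (fun q : Fin 3 × Fin 3 => if q.1 = kx then LinearIsometryEquiv.neg ℝ (E := ℝ) else LinearIsometryEquiv.refl ℝ ℝ) z else z) = f 0 z := by
    intro kx b z
    cases b
    · rw [if_neg Bool.false_ne_true]
    · rw [if_pos rfl, groundState_rowNeg_of_isEigenFamily hf hpos kx z]
  have hoptap : ∀ (kx : Fin 3) (b : Bool) (z : ZM) (p : Fin 3 × Fin 3), (if b = true then LinearIsometryEquiv.piLpCongrRight 2
      (fun q : Fin 3 × Fin 3 => if q.1 = kx then LinearIsometryEquiv.neg ℝ (E := ℝ) else LinearIsometryEquiv.refl ℝ ℝ) z else z) p =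
      if b = true ∧ p.1 = kx then -z p else z p := by
    intro kx b z p
    cases b
    · rw [if_neg Bool.false_ne_true, if_neg fun h => Bool.false_ne_true h.1]
    · rw [if_pos rfl, rowNeg_apply]
      by_cases h : p.1 = kx
      · rw [if_pos h, if_pos ⟨rfl, h⟩]
      · rw [if_neg h, if_neg fun h' => h h'.2]
  set M : Fin 3 → ZM → ZM := fun kx z => if s kx = true then LinearIsometryEquiv.piLpCongrRight 2
      (fun q : Fin 3 × Fin 3 => if q.1 = kx then LinearIsometryEquiv.neg ℝ (E := ℝ) else LinearIsometryEquiv.refl ℝ ℝ) z else z with hM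
  have hfac : LinearIsometryEquiv.piLpCongrRight 2
      (fun q : Fin 3 × Fin 3 => if s q.1 = true then LinearIsometryEquiv.neg ℝ (E := ℝ) else LinearIsometryEquiv.refl ℝ ℝ) y = M 0 (M 1 (M 2 y)) := by
    ext p
    rw [signFlip_apply, hM]
    simp only []
    rw [hoptap, hoptap, hoptap]
    obtain ⟨i, a⟩ := p
    fin_cases i
    · by_cases h : s 0 = true
      · simp [h]
      · simp [h]
    · by_cases h : s 1 = true
      · simp [h]
      · simp [h]
    · by_cases h : s 2 = true
      · simp [h]
      · simp [h]
  rw [hfac]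
  show f 0 (M 0 (M 1 (M 2 y))) = f 0 y
  rw [hM]
  simp only []
  rw [hopt 0, hopt 1, hopt 2]

/-! ## §2 The signed axis permutations `B₃` on the one-site links -/

/-- The inverse pairing `(s, π) ↦ (s ∘ π, π⁻¹)` on `B₃ = (Fin 3 → Bool) × S₃` is an involution. [folklore] -/
theorem octPair_involutive :
    Function.Involutive fun g : (Fin 3 → Bool) × Equiv.Perm (Fin 3) => ((g.1 ∘ ⇑g.2 : Fin 3 → Bool), g.2⁻¹) := by
  intro g
  obtain ⟨s, σp⟩ := g
  simp only [inv_inv, Prod.mk.injEq, and_true]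
  funext i
  simp only [Function.comp_apply, Equiv.Perm.inv_def, Equiv.apply_symm_apply]

/-- `γ_g ∘ γ_{ι g} = id` for the signed axis permutation `γ_{(s,π)} V = linkFlip s (configPerm π V)` and `ι (s, π) = (s ∘ π, π⁻¹)`. [folklore] -/
theorem octAct_pair (g : (Fin 3 → Bool) × Equiv.Perm (Fin 3)) (V : Cfg) :
    linkFlip g.1 (configPerm g.2 (linkFlip (g.1 ∘ ⇑g.2) (configPerm g.2⁻¹ V))) = V := by
  funext e
  obtain ⟨x, μ⟩ := e
  have hx : ∀ y : Site 3 1, y = x := fun y => Subsingleton.elim y x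
  simp only [linkFlip, configPerm_apply, hx (sitePerm _ _), Function.comp_apply, Equiv.Perm.inv_def, Equiv.symm_symm,
    Equiv.apply_symm_apply]
  cases g.1 μ
  · simp
  · simp

/-- Every signed axis permutation is a lift symmetry. [cite: Luscher1983, §2] -/
theorem isLiftSymmetry_octAct (g : (Fin 3 → Bool) × Equiv.Perm (Fin 3)) :
    IsLiftSymmetry fun V : Cfg => linkFlip g.1 (configPerm g.2 V) :=
  (isLiftSymmetry_linkFlip g.1).comp (isLiftSymmetry_configPerm g.2)

/-- ★ **The root chart intertwines the signed axis permutation `(s, π)` with the signed row permutation `N_s ∘ P_π`.** [cite: Luscher1983, §2] -/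
theorem rootCoord_octAct (L : ℕ) (μ : ℝ) (g : (Fin 3 → Bool) × Equiv.Perm (Fin 3)) (V : Cfg) :
    rootCoord L μ (linkFlip g.1 (configPerm g.2 V)) =
      LinearIsometryEquiv.piLpCongrRight 2
          (fun q : Fin 3 × Fin 3 => if g.1 q.1 = true then LinearIsometryEquiv.neg ℝ (E := ℝ) else LinearIsometryEquiv.refl ℝ ℝ)
        (LinearIsometryEquiv.piLpCongrLeft 2 ℝ ℝ (g.2.prodCongr (Equiv.refl (Fin 3))) (rootCoord L μ V)) := by
  rw [rootCoord_linkFlip L μ g.1 (configPerm g.2 V), rootCoord_configPerm]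

/-! ## §3 ★★ The `B₃` twirl transfers -/

/-- ★★ **Signed-permutation (`B₃`) twirls transfer to transplant bases.**  Let `w : B₃ → ℝ` be symmetric under the inverse pairing `(s, π) ↦ (s ∘ π, π⁻¹)`.  If the
FLAT twirl `y ↦ Σ_{(s,π)} w_{(s,π)} f_{i+1}(N_s P_π y)` equals `f_{i+1}` and the same twirl of `f_{l+1}` vanishes (or vice versa) — by Schur orthogonality this is
the case with `w_g = (d/48)·⟨p, D(g) p⟩/‖p‖²` whenever `f_{i+1}` spans the row `p` of an irreducible `B₃`-multiplet `D` (dimension `d`) and `f_{l+1}` has no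
component along that row of any equivalent multiplet — then the transplanted pair of an AL1 family with `f_0 > 0` is `PairSeparated` (clause (b)).
[cite: Luscher1983, §2–§3] [cite: LuscherMunster1984, §4] -/
theorem pairSeparated_transplantObsL_of_octTwirl (L : ℕ) (Λ R : ℝ) {f : Fin (k + 1) → ZM → ℝ} (hf : IsEigenFamily k f) (hpos : ∀ x, 0 < f 0 x)
    (w : (Fin 3 → Bool) × Equiv.Perm (Fin 3) → ℝ) (hw : ∀ g : (Fin 3 → Bool) × Equiv.Perm (Fin 3), w ((g.1 ∘ ⇑g.2 : Fin 3 → Bool), g.2⁻¹) = w g) {i l : Fin k}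
    (havg : ((∀ y, ∑ g : (Fin 3 → Bool) × Equiv.Perm (Fin 3), w g * f i.succ (LinearIsometryEquiv.piLpCongrRight 2
          (fun q : Fin 3 × Fin 3 => if g.1 q.1 = true then LinearIsometryEquiv.neg ℝ (E := ℝ) else LinearIsometryEquiv.refl ℝ ℝ)
          (LinearIsometryEquiv.piLpCongrLeft 2 ℝ ℝ (g.2.prodCongr (Equiv.refl (Fin 3))) y)) = f i.succ y) ∧
        (∀ y, ∑ g : (Fin 3 → Bool) × Equiv.Perm (Fin 3), w g * f l.succ (LinearIsometryEquiv.piLpCongrRight 2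
          (fun q : Fin 3 × Fin 3 => if g.1 q.1 = true then LinearIsometryEquiv.neg ℝ (E := ℝ) else LinearIsometryEquiv.refl ℝ ℝ)
          (LinearIsometryEquiv.piLpCongrLeft 2 ℝ ℝ (g.2.prodCongr (Equiv.refl (Fin 3))) y)) = 0)) ∨
      ((∀ y, ∑ g : (Fin 3 → Bool) × Equiv.Perm (Fin 3), w g * f l.succ (LinearIsometryEquiv.piLpCongrRight 2
          (fun q : Fin 3 × Fin 3 => if g.1 q.1 = true then LinearIsometryEquiv.neg ℝ (E := ℝ) else LinearIsometryEquiv.refl ℝ ℝ)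
          (LinearIsometryEquiv.piLpCongrLeft 2 ℝ ℝ (g.2.prodCongr (Equiv.refl (Fin 3))) y)) = f l.succ y) ∧
        (∀ y, ∑ g : (Fin 3 → Bool) × Equiv.Perm (Fin 3), w g * f i.succ (LinearIsometryEquiv.piLpCongrRight 2
          (fun q : Fin 3 × Fin 3 => if g.1 q.1 = true then LinearIsometryEquiv.neg ℝ (E := ℝ) else LinearIsometryEquiv.refl ℝ ℝ)
          (LinearIsometryEquiv.piLpCongrLeft 2 ℝ ℝ (g.2.prodCongr (Equiv.refl (Fin 3))) y)) = 0))) :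
    PairSeparated (transplantObsL L Λ R f i) (transplantObsL L Λ R f l) :=
  pairSeparated_transplantObsL_of_twirl L Λ R (fun g V => linkFlip g.1 (configPerm g.2 V))
    (fun g y => LinearIsometryEquiv.piLpCongrRight 2
        (fun q : Fin 3 × Fin 3 => if g.1 q.1 = true then LinearIsometryEquiv.neg ℝ (E := ℝ) else LinearIsometryEquiv.refl ℝ ℝ)
      (LinearIsometryEquiv.piLpCongrLeft 2 ℝ ℝ (g.2.prodCongr (Equiv.refl (Fin 3))) y))
    (Function.Involutive.toPerm _ octPair_involutive) w
    (fun g => isLiftSymmetry_octAct g) (fun g V => octAct_pair g V) (fun g => hw g)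
    (fun g U => rootCoord_octAct L (Λ / 2) g U)
    (fun g y => by rw [LinearIsometryEquiv.norm_map, LinearIsometryEquiv.norm_map])
    (fun g y => by rw [groundState_signFlip_of_isEigenFamily hf hpos, groundState_rowPerm_of_isEigenFamily hf hpos]) havg

end Summit.QuantumFields.YangMills.Theorems.FemtoTransferGap.PolyakovLift

end
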